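import Summits.ValiantsHypothesis.ValiantsHypothesis.Theorems.BarrierLeverTropicalDetCertificatesSymmetries
import Summits.ValiantsHypothesis.ValiantsHypothesis.Theses.BarrierLever

/-!
# Route BarrierLever — glue item `ChainCertificatesSufficeForTropicalDet`
# (stmt-ValiantsHypothesis-19653), PROVED

Closing file (`--workitem stmt-ValiantsHypothesis-19653`; cell valiant-natproofs, rung V4, 𝒟-side;
prover seat valiant-natproofs-prover gen 7; item typed by planner p1-g10). The item is the glue
`ChainCertificateSuffices → ChainCertificatesExist → TropicalDetCertificatesExist`
(items 19651 → 19652 → 19316): chain certificates in SOME coordinate order `γ` for every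
injective layout, together with the (pointwise) reduction «chain certificate ⇒ tropical-determinant
certificate», give UT-D.

**Proof.** Fix an injective layout `(u, w)`. `ChainCertificatesExist` supplies a coordinate order
`γ : Perm (Fin h)` and a chain certificate `(e, f, π₀, S₀)` whose membership tests are read in the
RELABELLED layout `u' i = (u i).map γ`, `w' j = (w j).map γ` while its side conditions
(`u i = w j → π₀ j = i`, the filters `u (π₀ j) ≠ w j`) are stated for `(u, w)`; since `Finset.map`
along an embedding is injective these side conditions are the same for `(u', w')`, so the data IS
a chain certificate for the (injective) layout `(u', w')` in the format of `ChainCertificateSuffices`.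
That hypothesis turns it into a tropical-determinant certificate for `(u', w')`, i.e.
`UTDSymm.HasCert u' w'` (`UTDSymm.hasCert_iff`, `Iff.rfl`), and the relabelling symmetries of UT-D
(`UTDSymm.hasCert_of_relabelRows` / `hasCert_of_relabelCols`, tree file
`…TropicalDetCertificatesSymmetries`) pull it back to `HasCert u w`, which is verbatim the
conclusion of `TropicalDetCertificatesExist` for `(u, w)`.

WHAT THIS IS NOT: bookkeeping only; `ChainCertificatesExist` (19652) is an OPEN conjecture and
nothing here bears on it, on UT-D / TT / TNS / item 19717 unconditionally, on crux
stmt-ValiantsHypothesis-14610, or on `VP` versus `VNP`.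
-/

-- layout Summits/ValiantsHypothesis/ValiantsHypothesis forces the duplicated namespace component
set_option linter.dupNamespace false

namespace Summit.ValiantsHypothesis.ValiantsHypothesis.Theorems.BarrierLever.ChainGlue

open Finset
open Summit.ValiantsHypothesis.ValiantsHypothesis.Theses.BarrierLever
  (ChainCertificateSuffices ChainCertificatesExist TropicalDetCertificatesExist
    ChainCertificatesSufficeForTropicalDet)

/-- `Finset.map` along the embedding of a permutation is injective on finsets (as an `iff`). -/
theorem map_perm_inj {h : ℕ} (γ : Equiv.Perm (Fin h)) (x y : Finset (Fin h)) :
    x.map γ.toEmbedding = y.map γ.toEmbedding ↔ x = y :=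
  (Finset.map_injective γ.toEmbedding).eq_iff

/-- **Pointwise glue.** Under `ChainCertificateSuffices`, a chain certificate for the injective
layout `(u, w)` read in the coordinate order `γ` (the data of `ChainCertificatesExist` for
`(u, w)`) yields a tropical-determinant certificate for `(u, w)` (`UTDSymm.HasCert u w`). -/
theorem hasCert_of_chainCertificate_inOrder (hS : ChainCertificateSuffices) {h r : ℕ}
    (u w : Fin r → Finset (Fin h)) (hu : Function.Injective u) (hw : Function.Injective w)
    (γ : Equiv.Perm (Fin h)) (e f : Fin h → Bool → Fin h → Bool → ℕ) (π₀ : Equiv.Perm (Fin r))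
    (S₀ : Fin r → Finset (Fin h))
    (hcert : (∀ i j, u i = w j → π₀ j = i) ∧
      (∀ j, u (π₀ j) ≠ w j → (Finset.univ.filter fun a : Fin h =>
        ¬ (a ∈ (u (π₀ j)).map γ.toEmbedding ↔ a ∈ (w j).map γ.toEmbedding)) ⊆ S₀ j) ∧
      ∀ (σ : Equiv.Perm (Fin r)) (S : Fin r → Finset (Fin h)), σ ≠ π₀ →
        (∀ i j, u i = w j → σ j = i) →
        (∀ j, u (σ j) ≠ w j → (Finset.univ.filter fun a : Fin h =>
          ¬ (a ∈ (u (σ j)).map γ.toEmbedding ↔ a ∈ (w j).map γ.toEmbedding)) ⊆ S j) →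
        (∑ j ∈ Finset.univ.filter (fun j : Fin r => u (π₀ j) ≠ w j), ∑ x ∈ S₀ j, ∑ y ∈ S₀ j,
          ((if (∀ z ∈ S₀ j, z ≤ x) ∧ (∀ z ∈ S₀ j, y ≤ z) then
              e x (decide (x ∈ (u (π₀ j)).map γ.toEmbedding)) y
                (decide (y ∈ (w j).map γ.toEmbedding)) else 0) +
            (if x < y ∧ (∀ z ∈ S₀ j, ¬ (x < z ∧ z < y)) then
              f x (decide (x ∈ (u (π₀ j)).map γ.toEmbedding)) y
                (decide (y ∈ (w j).map γ.toEmbedding)) else 0))) <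
        (∑ j ∈ Finset.univ.filter (fun j : Fin r => u (σ j) ≠ w j), ∑ x ∈ S j, ∑ y ∈ S j,
          ((if (∀ z ∈ S j, z ≤ x) ∧ (∀ z ∈ S j, y ≤ z) then
              e x (decide (x ∈ (u (σ j)).map γ.toEmbedding)) y
                (decide (y ∈ (w j).map γ.toEmbedding)) else 0) +
            (if x < y ∧ (∀ z ∈ S j, ¬ (x < z ∧ z < y)) then
              f x (decide (x ∈ (u (σ j)).map γ.toEmbedding)) y
                (decide (y ∈ (w j).map γ.toEmbedding)) else 0)))) :
    UTDSymm.HasCert u w := by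
  have hu' : Function.Injective (fun i => (u i).map γ.toEmbedding) := fun i i' hii' =>
    hu ((map_perm_inj γ _ _).mp hii')
  have hw' : Function.Injective (fun j => (w j).map γ.toEmbedding) := fun j j' hjj' =>
    hw ((map_perm_inj γ _ _).mp hjj')
  have key := hS h r (fun i => (u i).map γ.toEmbedding) (fun j => (w j).map γ.toEmbedding) hu' hw'
    (by
      refine ⟨e, f, π₀, S₀, ?_⟩
      simpa only [map_perm_inj, ne_eq] using hcert)
  have hc : UTDSymm.HasCert (fun i => (u i).map γ.toEmbedding) (fun j => (w j).map γ.toEmbedding) :=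
    (UTDSymm.hasCert_iff _ _).mpr key
  exact UTDSymm.hasCert_of_relabelCols u w γ
    (UTDSymm.hasCert_of_relabelRows u (fun j => (w j).map γ.toEmbedding) γ hc)

/-- **Item stmt-ValiantsHypothesis-19653 `ChainCertificatesSufficeForTropicalDet`**, stated as the
route declaration itself: `ChainCertificateSuffices → ChainCertificatesExist →
TropicalDetCertificatesExist`. -/
theorem chainCertificatesSufficeForTropicalDet : ChainCertificatesSufficeForTropicalDet := by
  intro hS hE h r u w hu hw
  obtain ⟨γ, e, f, π₀, S₀, hcert⟩ := hE h r u w hu hw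
  exact (UTDSymm.hasCert_iff u w).mp
    (hasCert_of_chainCertificate_inOrder hS u w hu hw γ e f π₀ S₀ hcert)

end Summit.ValiantsHypothesis.ValiantsHypothesis.Theorems.BarrierLever.ChainGlue
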